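import Mathlib
import Summits.CriticalPhenomena.CardyFormulaZ2.Theorems.CardyMagicRigidityNestingRigidityLoopCrossCountT
import Summits.CriticalPhenomena.CardyFormulaZ2.Theorems.CardyMagicRigidityNestingRigidityLoopCrossCountZ2Clusters
import Literature.Probability.Percolation.SharpnessDCTProofs
import Literature.Probability.Percolation.QuadLowestCrossingProofs
import HarnessLib

/-!
# Crux `NestingRigidity`, line `ring-cloud-tomography` (r5): keystone K2 — two-arm decay of the
# expected NUMBER of loops meeting a small ball and leaving a big one, on BOTH lattices

Crux `Summit.CriticalPhenomena.CardyFormulaZ2.Theses.CardyMagicRigidity.NestingRigidity`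
(stmt-CriticalPhenomena-4835), line `ring-cloud-tomography`, keystone helper K2.  The registered K2
`integral_ncard_loops_cross_le` (∀ `E ∈ latticeEnsembles`, `E[#{loops of X_δ meeting B̄(x,a) and
ℂ ∖ B(x,b)}] ≤ C (a/b)^c` for `0 < δ`, `c₀ δ ≤ a`, `a < b`) is FALSE as registered: with `b ↓ a`
every microscopic loop straddling the circle `∂B(x, a)` is counted and the expectation is of order
`a/δ → ∞`.  This file proves the CORRECTED statement, with the aspect-ratio hypothesis `4a ≤ b`
(anchor `integral_ncard_loops_cross_le_of_four_mul_le`; any fixed ratio `> 1` is true, `4` is what the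
tree's ratio-`2` RSW annulus bounds give after the `O(δ)` fattening of the lattice arms):

* §1 **the geometric tail on bond-`ℤ²`** (`LoopCrossCount.measureReal_le_ncard_cross_zEns`):
  `P(2k ≤ N) ≤ 2 (2^{-α})^k` for `c₀ δ ≤ a`, `2δ ≤ a`, `4a ≤ b` — the deterministic core
  `mem_disjointOccurrencePow_or_dualConfig_of_le_ncard_cross_zEns` (`…LoopCrossCountZ2Clusters`:
  distinct counter-clockwise loops have distinct rim clusters, "a cluster has one top"; clockwise
  loops are counter-clockwise loops of the dual, `…BondDuality`) puts such `ω` in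
  `(annulusOpenCrossing x δ (a+δ) (4a-δ))^{□k}` or its dual in the same event about `x - δ(1+i)/2`;
  then iterated BK–Reimer (`measureReal_disjointOccurrencePow_le`), the RSW annulus bound
  `annulusOpenCrossing_half_le_holds` (Grimmett 1999, §11.8) and self-duality;
* §2 **the bond-`ℤ²` half** `integral_ncard_loops_cross_le_zEns`, by the abstract summation
  `LoopCrossCount.integral_natCast_le_of_tails` of `…LoopCrossCountT` fed with
  `GapCrossing.measure_loop_cross_le_zEns` (`P(1 ≤ N) ≤ C₁ (a/b)^{c₁}`) and §1; `c = c₁/2`;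
* §3 **both lattices** (`integral_ncard_loops_cross_le_of_four_mul_le`), with the site-`𝕋` half
  `integral_ncard_loops_cross_le_tEns` of `…LoopCrossCountT`.
-/

noncomputable section

open MeasureTheory Set Filter Metric
open scoped Real Topology BigOperators ENNReal

namespace Summit.CriticalPhenomena.CardyFormulaZ2.Cruxes.NestingRigidity.RingCloudTomography

open Literature.Probability.RandomPlanarGeometry Literature.Probability.Percolation
  Literature.Probability.LatticeModels
open Literature.Probability.Percolation.DCT16 (real_mono_of_forall_subset_edgeSet)
open Literature.Probability.Percolation.SSContinuity (measure_preimage_dualConfig_le)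

namespace LoopCrossCount

/-! ## §1 Bond-`ℤ²`: the geometric tail of the crossing count -/

/-- **Geometric tail of the crossing count on bond-`ℤ²`** (iterated BK–Reimer
`measureReal_disjointOccurrencePow_le`, the RSW annulus bound in the form of the hypothesis `hbd`
— discharged by `annulusOpenCrossing_half_le_holds` —, self-duality
`SSContinuity.measure_preimage_dualConfig_le` and the almost sure restriction to lattice
configurations `DCT16.real_mono_of_forall_subset_edgeSet`): for `c₀ δ ≤ a`, `2δ ≤ a`,
`4a ≤ b`, the probability that at least `2k` loops of `X_δ = bondLoopConfig δ 0` meet `B̄(x, a)` and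
`ℂ ∖ B(x, b)` is at most `2 (2^{-α})^k`: by the deterministic core
`mem_disjointOccurrencePow_or_dualConfig_of_le_ncard_cross_zEns` (`…LoopCrossCountZ2Clusters`) such
a configuration has `k` disjoint open crossings of `A(x; a + δ, 4a - δ)`, or its dual has `k` disjoint
open crossings of the same annulus about `x - δ(1+i)/2`. -/
theorem measureReal_le_ncard_cross_zEns {α c₀ : ℝ} (hα : 0 < α)
    (hbd : ∀ (x : ℂ) (δ r R : ℝ), 0 < δ → c₀ * δ ≤ r → 2 * r ≤ R →
      (bondPercolation (zdGraph 2) half).real (annulusOpenCrossing x δ r R) ≤ (r / R) ^ α)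
    {δ : ℝ} (hδ : 0 < δ) (x : ℂ) {a b : ℝ} (hc₀a : c₀ * δ ≤ a) (h2a : 2 * δ ≤ a) (hab : 4 * a ≤ b)
    (k : ℕ) :
    zEns.P.real {ω | 2 * k ≤ {u ∈ (zEns.X δ ω).loops |
        (u.range ∩ Metric.closedBall x a).Nonempty ∧ (u.range ∩ (Metric.ball x b)ᶜ).Nonempty}.ncard} ≤
      2 * ((1 / 2 : ℝ) ^ α) ^ k := by
  change (bondPercolation (zdGraph 2) half).real _ ≤ _
  obtain ⟨M, hM⟩ := exists_ncard_cross_le zEns zEns_mem hδ x a (4 * a)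
  -- inclusion on lattice configurations
  have hincl : ∀ ω : BondConfig (Site 2), ω ⊆ (zdGraph 2).edgeSet →
      ω ∈ {ω | 2 * k ≤ {u ∈ (zEns.X δ ω).loops | (u.range ∩ Metric.closedBall x a).Nonempty ∧
        (u.range ∩ (Metric.ball x b)ᶜ).Nonempty}.ncard} →
      ω ∈ disjointOccurrencePow (annulusOpenCrossing x δ (a + δ) (4 * a - δ)) k ∪
        dualConfig ⁻¹' disjointOccurrencePow
          (annulusOpenCrossing (x - δ * (1 + Complex.I) / 2) δ (a + δ) (4 * a - δ)) k := by
    intro ω hω hk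
    have hsub : {u ∈ (zEns.X δ ω).loops | (u.range ∩ Metric.closedBall x a).Nonempty ∧
        (u.range ∩ (Metric.ball x b)ᶜ).Nonempty} ⊆
        {u ∈ (zEns.X δ ω).loops | (u.range ∩ Metric.closedBall x a).Nonempty ∧
          (u.range ∩ (Metric.ball x (4 * a))ᶜ).Nonempty} := by
      rintro u ⟨hu, hza, z', hz'u, hz'b⟩
      exact ⟨hu, hza, z', hz'u, fun h ↦ hz'b (Metric.ball_subset_ball hab h)⟩
    have hk' : 2 * k ≤ {u ∈ (zEns.X δ ω).loops | (u.range ∩ Metric.closedBall x a).Nonempty ∧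
        (u.range ∩ (Metric.ball x (4 * a))ᶜ).Nonempty}.ncard :=
      le_trans hk (Set.ncard_le_ncard hsub (hM ω).1)
    rcases mem_disjointOccurrencePow_or_dualConfig_of_le_ncard_cross_zEns ω δ x a (4 * a) k hω hδ
      (by linarith) hk' with h | h
    · exact Or.inl h
    · exact Or.inr h
  -- the one-crossing probabilities
  have hq : ∀ y : ℂ, (bondPercolation (zdGraph 2) half).real
      (annulusOpenCrossing y δ (a + δ) (4 * a - δ)) ≤ (1 / 2 : ℝ) ^ α := by
    intro y
    refine (hbd y δ (a + δ) (4 * a - δ) hδ (by linarith) (by linarith)).trans ?_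
    refine Real.rpow_le_rpow (div_nonneg (by linarith) (by linarith)) ?_ hα.le
    rw [div_le_div_iff₀ (by linarith) (by norm_num)]
    linarith
  have hD : ∀ y : ℂ, (bondPercolation (zdGraph 2) half).real
      (disjointOccurrencePow (annulusOpenCrossing y δ (a + δ) (4 * a - δ)) k) ≤ ((1 / 2 : ℝ) ^ α) ^ k :=
    fun y ↦ (measureReal_disjointOccurrencePow_le _ _ (isLocalEvent_annulusOpenCrossing hδ y _ _) k).trans
      (pow_le_pow_left₀ measureReal_nonneg (hq y) k)
  calc (bondPercolation (zdGraph 2) half).real {ω | 2 * k ≤ {u ∈ (zEns.X δ ω).loops |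
          (u.range ∩ Metric.closedBall x a).Nonempty ∧ (u.range ∩ (Metric.ball x b)ᶜ).Nonempty}.ncard}
      ≤ (bondPercolation (zdGraph 2) half).real
          (disjointOccurrencePow (annulusOpenCrossing x δ (a + δ) (4 * a - δ)) k ∪
            dualConfig ⁻¹' disjointOccurrencePow
              (annulusOpenCrossing (x - δ * (1 + Complex.I) / 2) δ (a + δ) (4 * a - δ)) k) :=
        real_mono_of_forall_subset_edgeSet (zdGraph 2) half hincl
    _ ≤ (bondPercolation (zdGraph 2) half).real
          (disjointOccurrencePow (annulusOpenCrossing x δ (a + δ) (4 * a - δ)) k) +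
        (bondPercolation (zdGraph 2) half).real (dualConfig ⁻¹' disjointOccurrencePow
          (annulusOpenCrossing (x - δ * (1 + Complex.I) / 2) δ (a + δ) (4 * a - δ)) k) :=
        measureReal_union_le _ _
    _ ≤ ((1 / 2 : ℝ) ^ α) ^ k + ((1 / 2 : ℝ) ^ α) ^ k :=
        add_le_add (hD x) ((ENNReal.toReal_mono (measure_ne_top _ _)
          (measure_preimage_dualConfig_le _)).trans (hD _))
    _ = 2 * ((1 / 2 : ℝ) ^ α) ^ k := by ring

end LoopCrossCount

/-! ## §2 The expected number of crossing loops on bond-`ℤ²` -/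

/-- **Two-arm decay of the expected NUMBER of loops of bond-`ℤ²` meeting a small ball and leaving a
big one.**  There are `c, C, c₀ > 0` such that for every centre `x`, mesh `δ > 0` and radii with
`c₀ δ ≤ a` and `4a ≤ b`, the number of loops of `X_δ = bondLoopConfig δ 0` whose trace meets both
`B̄(x, a)` and `ℂ ∖ B(x, b)` is integrable with expectation at most `C (a/b)^c`: the probability of
at least one such loop is `≤ C₁ (a/b)^{c₁}` (`GapCrossing.measure_loop_cross_le_zEns`), of at least
`2j + 2` it is `≤ 2 · 2^{-α (j+1)}` (`LoopCrossCount.measureReal_le_ncard_cross_zEns`), and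
`LoopCrossCount.integral_natCast_le_of_tails` sums; `c = c₁ / 2`. -/
theorem integral_ncard_loops_cross_le_zEns : ∃ c C c₀ : ℝ, 0 < c ∧ 0 < C ∧ 0 < c₀ ∧
    ∀ (x : ℂ) (a b δ : ℝ), 0 < δ → c₀ * δ ≤ a → 4 * a ≤ b →
      Integrable (fun ω ↦ ({u ∈ (zEns.X δ ω).loops | (u.range ∩ Metric.closedBall x a).Nonempty ∧
        (u.range ∩ (Metric.ball x b)ᶜ).Nonempty}.ncard : ℝ)) zEns.P ∧
      ∫ ω, ({u ∈ (zEns.X δ ω).loops | (u.range ∩ Metric.closedBall x a).Nonempty ∧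
        (u.range ∩ (Metric.ball x b)ᶜ).Nonempty}.ncard : ℝ) ∂zEns.P ≤ C * (a / b) ^ c := by
  haveI : IsProbabilityMeasure zEns.P := isProbabilityMeasure_of_mem zEns_mem
  obtain ⟨c₁, C₁, k₁, hc₁, hC₁, hk₁, hP⟩ := GapCrossing.measure_loop_cross_le_zEns
  obtain ⟨α, c₀, hα, hc₀, hbd⟩ := annulusOpenCrossing_half_le_holds
  set t : ℝ := (1 / 2 : ℝ) ^ (α / 4) with ht
  have ht0 : 0 ≤ t := by positivity
  have ht1 : t < 1 := Real.rpow_lt_one (by norm_num) (by norm_num) (by positivity)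
  have hθ1 : (1 / 2 : ℝ) ^ α ≤ 1 := Real.rpow_le_one (by norm_num) (by norm_num) hα.le
  have htpow : ∀ j : ℕ, ((1 / 2 : ℝ) ^ α) ^ j = t ^ (4 * j) := fun j ↦ by
    rw [ht, ← Real.rpow_natCast, ← Real.rpow_natCast, ← Real.rpow_mul (by norm_num),
      ← Real.rpow_mul (by norm_num)]
    congr 1
    push_cast
    ring
  refine ⟨c₁ / 2, C₁ + 2 * Real.sqrt (C₁ * 2) / (1 - t), max (max k₁ c₀) 2, by positivity, ?_,
    by positivity, fun x a b δ hδ ha hab ↦ ?_⟩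
  · have : 0 < 2 * Real.sqrt (C₁ * 2) / (1 - t) := by
      have := Real.sqrt_pos.2 (show 0 < C₁ * 2 by positivity)
      have : 0 < 1 - t := by linarith
      positivity
    linarith
  have hk₁a : k₁ * δ ≤ a :=
    le_trans (mul_le_mul_of_nonneg_right ((le_max_left _ _).trans (le_max_left _ _)) hδ.le) ha
  have hc₀a : c₀ * δ ≤ a :=
    le_trans (mul_le_mul_of_nonneg_right ((le_max_right _ _).trans (le_max_left _ _)) hδ.le) ha
  have h2a : 2 * δ ≤ a := le_trans (mul_le_mul_of_nonneg_right (le_max_right _ _) hδ.le) ha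
  have ha0 : 0 < a := by linarith
  have hb0 : 0 < b := by linarith
  have hr0 : 0 ≤ a / b := by positivity
  have hr1 : a / b ≤ 1 := by rw [div_le_one hb0]; linarith
  refine ⟨LoopCrossCount.integrable_ncard_cross zEns zEns_mem hδ x a b, ?_⟩
  obtain ⟨M, hM⟩ := LoopCrossCount.exists_ncard_cross_le zEns zEns_mem hδ x a b
  set p : ℝ := C₁ * (a / b) ^ c₁ with hp
  have hp0 : 0 ≤ p := by positivity
  have h1 : zEns.P.real {ω | 1 ≤ {u ∈ (zEns.X δ ω).loops | (u.range ∩ Metric.closedBall x a).Nonempty ∧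
      (u.range ∩ (Metric.ball x b)ᶜ).Nonempty}.ncard} ≤ p := by
    have hsub : {ω | 1 ≤ {u ∈ (zEns.X δ ω).loops | (u.range ∩ Metric.closedBall x a).Nonempty ∧
        (u.range ∩ (Metric.ball x b)ᶜ).Nonempty}.ncard} ⊆
        {ω | ∃ u ∈ (zEns.X δ ω).loops, (u.range ∩ closedBall x a).Nonempty ∧
          (u.range ∩ (ball x b)ᶜ).Nonempty} := by
      intro ω hω
      obtain ⟨u, hu⟩ := Set.nonempty_of_ncard_ne_zero (Nat.one_le_iff_ne_zero.1 hω)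
      exact ⟨u, hu.1, hu.2⟩
    refine (measureReal_mono hsub).trans ?_
    exact ENNReal.toReal_le_of_le_ofReal hp0 (hP x a b δ hδ hk₁a hb0)
  have htail : ∀ j : ℕ, zEns.P.real {ω | 2 * j + 2 ≤ {u ∈ (zEns.X δ ω).loops |
      (u.range ∩ Metric.closedBall x a).Nonempty ∧ (u.range ∩ (Metric.ball x b)ᶜ).Nonempty}.ncard} ≤
      2 * t ^ (4 * j) := fun j ↦ by
    rw [← htpow]
    have h := LoopCrossCount.measureReal_le_ncard_cross_zEns hα hbd hδ x hc₀a h2a hab (j + 1)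
    rw [show 2 * (j + 1) = 2 * j + 2 by ring] at h
    refine h.trans (mul_le_mul_of_nonneg_left ?_ (by norm_num))
    rw [pow_succ]
    exact mul_le_of_le_one_right (by positivity) hθ1
  have hmain := LoopCrossCount.integral_natCast_le_of_tails zEns.P
    (LoopCrossCount.measurable_ncard_cross zEns zEns_mem δ x a b) (fun ω ↦ (hM ω).2) hp0
    (by norm_num : (0 : ℝ) ≤ 2) ht0 ht1 h1 htail
  refine hmain.trans ?_
  have hhalf : (a / b) ^ c₁ = ((a / b) ^ (c₁ / 2)) ^ 2 := by
    rw [← Real.rpow_natCast, ← Real.rpow_mul hr0]; congr 1; push_cast; ring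
  have hs0 : 0 ≤ (a / b) ^ (c₁ / 2) := by positivity
  have hs1 : (a / b) ^ (c₁ / 2) ≤ 1 := Real.rpow_le_one hr0 hr1 (by positivity)
  have hsqrt : Real.sqrt (p * 2) = Real.sqrt (C₁ * 2) * (a / b) ^ (c₁ / 2) := by
    rw [hp, hhalf, show C₁ * ((a / b) ^ (c₁ / 2)) ^ 2 * 2 = (C₁ * 2) * ((a / b) ^ (c₁ / 2)) ^ 2 by
      ring, Real.sqrt_mul (by positivity), Real.sqrt_sq hs0]
  have hple : p ≤ C₁ * (a / b) ^ (c₁ / 2) := by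
    rw [hp, hhalf, sq, ← mul_assoc]
    exact mul_le_of_le_one_right (by positivity) hs1
  have h1t : 0 < 1 - t := by linarith
  rw [hsqrt]
  calc p + 2 * (Real.sqrt (C₁ * 2) * (a / b) ^ (c₁ / 2)) / (1 - t)
      ≤ C₁ * (a / b) ^ (c₁ / 2) + 2 * (Real.sqrt (C₁ * 2) * (a / b) ^ (c₁ / 2)) / (1 - t) := by
        linarith
    _ = (C₁ + 2 * Real.sqrt (C₁ * 2) / (1 - t)) * (a / b) ^ (c₁ / 2) := by
        field_simp

/-! ## §3 Both lattice ensembles (the corrected keystone K2) -/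

/-- **Keystone K2 (corrected): two-arm decay of the expected NUMBER of loops meeting a small ball
and leaving a big one, on both lattice ensembles of the crux.**  For `E ∈ latticeEnsembles` there are
`c, C, c₀ > 0` such that for every centre `x : ℂ`, every mesh `δ > 0` and all radii with `c₀ δ ≤ a`
and `4a ≤ b`, the number `N` of loops of `X_δ` whose trace meets both `B̄(x, a)` and `ℂ ∖ B(x, b)` is
integrable and `E[N] ≤ C (a/b)^c` (`integral_ncard_loops_cross_le_zEns`,
`integral_ncard_loops_cross_le_tEns`).  The registered K2 `integral_ncard_loops_cross_le` asked this
under `a < b` only, which is false (for `b ↓ a` the count of microscopic loops straddling the circle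
`∂B(x, a)` has expectation of order `a/δ`); any fixed aspect ratio `> 1` is fine, `4` is what the
tree's ratio-`2` RSW annulus bounds give after the `O(δ)` fattening of the lattice arms. -/
theorem integral_ncard_loops_cross_le_of_four_mul_le : ∀ E ∈ latticeEnsembles, ∃ c C c₀ : ℝ,
    0 < c ∧ 0 < C ∧ 0 < c₀ ∧ ∀ (x : ℂ) (a b δ : ℝ), 0 < δ → c₀ * δ ≤ a → 4 * a ≤ b →
      Integrable (fun ω ↦ ({u ∈ (E.X δ ω).loops | (u.range ∩ Metric.closedBall x a).Nonempty ∧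
        (u.range ∩ (Metric.ball x b)ᶜ).Nonempty}.ncard : ℝ)) E.P ∧
      ∫ ω, ({u ∈ (E.X δ ω).loops | (u.range ∩ Metric.closedBall x a).Nonempty ∧
        (u.range ∩ (Metric.ball x b)ᶜ).Nonempty}.ncard : ℝ) ∂E.P ≤ C * (a / b) ^ c := by
  intro E hE
  simp only [latticeEnsembles, Set.mem_insert_iff, Set.mem_singleton_iff] at hE
  rcases hE with rfl | rfl
  · exact integral_ncard_loops_cross_le_zEns
  · exact integral_ncard_loops_cross_le_tEns

end Summit.CriticalPhenomena.CardyFormulaZ2.Cruxes.NestingRigidity.RingCloudTomography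

end
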